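import Mathlib.Data.Nat.Choose.Basic
import Mathlib.Algebra.BigOperators.Intervals
import Mathlib.Algebra.Order.BigOperators.Group.Finset
import Mathlib.Tactic
import Summits.CriticalPhenomena.PercolationContinuityZ3.Theorems.PercNearOneGluingNoHeavyLowerTailUZero
import Summits.CriticalPhenomena.PercolationContinuityZ3.Theorems.PercNearOneGluingNoHeavyLowerTailLambdaMono
import HarnessLib

/-!
# CONJECTURE U: the reduction to the buffer-free case (merging the buffer into the second block)

Support file for the Sahi / Conjecture-P programme of route `PercNearOneGluingNoHeavy`
(`--supports stmt-CriticalPhenomena-4575`, prover prim-l12-p5 gen 28; proof note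
`prim-l12-p5/U-PROOF-g28.md` §1).  No definitions, no named facts, no sorries.

* `u_win` : for `2K + j = M₁ + M₂ + L` (`M₁, M₂ ≥ 1`), `κ ≥ 0` with `κ N(N-1) ≥ M₁M₂(N-j²)`, a centred WINDOW
  `[i₁, M₁-i₁]` on block 1 and ANY symmetric unimodal weight `w₂ ≥ 0` on block 2:
  `0 ≤ ∑_{x₁ ∈ window} C(M₁,x₁) [κ F₂(K-x₁) + (2x₁-M₁) Mo₂(K-x₁)]`, `(F₂, Mo₂)` the tilted weight / moment of the
  composite block 2 ∪ buffer (tree `CoreBlock` notation).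
Proof (note §1): re-index by the composite head count `h = K - x₁`; write `Mo₂(h) = (2h-n) v(h) C(n,h)`
(`n = M₂+L`) with `v` symmetric, nonnegative and unimodal about `n/2` by `LambdaMono.lam_step` (Lemma B1); Abel
summation in `h` (`Shells.abel_window`) against the doubly-windowed buffer-free sums of `UZero.propZ` with
`κ₀ = κ n/M₂`; finally `C(n,h) v(h) ≤ (M₂/n) F₂(h)` (`CoreBlock.Mo_upper`, Lemma B2, and `CoreBlock.F_step` at the
centre) and `κ₀ M₂/n = κ`.
-/

namespace Summit.CriticalPhenomena.PercolationContinuityZ3.Theorems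

namespace UWin

open Finset

/-- **The reduction (note §1).**  CONJECTURE U for a centred window on block 1 and an arbitrary symmetric
unimodal weight on block 2, all `(M₁, M₂, L, j)`. -/
theorem u_win (M₁ M₂ L K j i₁ : ℕ) (hN : 2 * K + j = M₁ + M₂ + L) (hM₁ : 1 ≤ M₁) (hM₂ : 1 ≤ M₂)
    (κ : ℝ) (hκ : 0 ≤ κ)
    (hκ₀ : (M₁ : ℝ) * M₂ * (((M₁ + M₂ + L : ℕ) : ℝ) - (j : ℝ) ^ 2) ≤
      κ * (((M₁ + M₂ + L : ℕ) : ℝ) * (((M₁ + M₂ + L : ℕ) : ℝ) - 1)))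
    (w₂ : ℕ → ℝ) (hw₂nn : ∀ x, 0 ≤ w₂ x) (hw₂sym : ∀ x, x ≤ M₂ → w₂ x = w₂ (M₂ - x))
    (hw₂uni : ∀ x, 2 * x + 2 ≤ M₂ → w₂ x ≤ w₂ (x + 1)) :
    0 ≤ ∑ x₁ ∈ range (M₁ + 1), (if i₁ ≤ x₁ ∧ x₁ ≤ M₁ - i₁ then (M₁.choose x₁ : ℝ) *
      (if x₁ ≤ K then
        κ * (∑ x ∈ range (M₂ + 1), (M₂.choose x : ℝ) *
            (if x ≤ K - x₁ then (L.choose (K - x₁ - x) : ℝ) else 0) * w₂ x) +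
        (2 * (x₁ : ℝ) - M₁) * (∑ x ∈ range (M₂ + 1), (M₂.choose x : ℝ) *
            (if x ≤ K - x₁ then (L.choose (K - x₁ - x) : ℝ) else 0) * w₂ x * (2 * (x : ℝ) - M₂))
      else 0) else 0) := by
  -- the composite block 2 ∪ buffer: n coins, weight FF, moment MM
  set FF : ℕ → ℝ := fun k => ∑ x ∈ range (M₂ + 1), (M₂.choose x : ℝ) *
    (if x ≤ k then (L.choose (k - x) : ℝ) else 0) * w₂ x with hFF
  set MM : ℕ → ℝ := fun k => ∑ x ∈ range (M₂ + 1), (M₂.choose x : ℝ) *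
    (if x ≤ k then (L.choose (k - x) : ℝ) else 0) * w₂ x * (2 * (x : ℝ) - M₂) with hMM
  have hFnn : ∀ k, 0 ≤ FF k := fun k => CoreBlock.F_nonneg M₂ L w₂ hw₂nn k
  have hFz : ∀ k, M₂ + L < k → FF k = 0 := fun k hk => CoreBlock.F_eq_zero_of_lt M₂ L w₂ k hk
  have hMz : ∀ k, M₂ + L < k → MM k = 0 := fun k hk => CoreBlock.Mo_eq_zero_of_lt M₂ L w₂ k hk
  have hFsym : ∀ k, k ≤ M₂ + L → FF (M₂ + L - k) = FF k := fun k hk => CoreBlock.F_symm M₂ L w₂ hw₂sym k hk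
  have hModd : ∀ k, k ≤ M₂ + L → MM (M₂ + L - k) = -MM k := fun k hk => CoreBlock.Mo_odd M₂ L w₂ hw₂sym k hk
  have hMnn : ∀ k, M₂ + L ≤ 2 * k → 0 ≤ MM k := fun k hk => CoreBlock.Mo_nonneg M₂ L w₂ hw₂sym hw₂nn k hk
  have hMup : ∀ k, M₂ + L ≤ 2 * k → ((M₂ : ℝ) + L) * MM k ≤ (2 * (k : ℝ) - M₂ - L) * M₂ * FF k :=
    fun k hk => CoreBlock.Mo_upper M₂ L w₂ hw₂sym hw₂uni k hk
  have hFstep : ∀ k, M₂ + L ≤ 2 * k + 1 → ((k : ℝ) + 1) * FF (k + 1) ≤ ((M₂ : ℝ) + L - k) * FF k :=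
    fun k hk => CoreBlock.F_step M₂ L w₂ hw₂sym hw₂uni k hk
  have hMcen : ∀ k, 2 * k = M₂ + L → MM k = 0 := fun k hk => LambdaMono.Mo_centre M₂ w₂ L hw₂sym k hk
  have hlam : ∀ h, M₂ + L < 2 * h → h + 1 ≤ M₂ + L →
      MM (h + 1) / ((2 * ((h : ℝ) + 1) - ((M₂ : ℝ) + L)) * ((M₂ + L).choose (h + 1) : ℝ)) ≤
      MM h / ((2 * (h : ℝ) - ((M₂ : ℝ) + L)) * ((M₂ + L).choose h : ℝ)) :=
    fun h h1 h2 => LambdaMono.lam_step M₂ w₂ hw₂sym hw₂uni L h h1 h2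
  have hn1 : 1 ≤ M₂ + L := by omega
  have hnpos : (0 : ℝ) < (M₂ : ℝ) + L := by
    have : ((1 : ℕ) : ℝ) ≤ ((M₂ + L : ℕ) : ℝ) := by exact_mod_cast hn1
    push_cast at this; linarith
  have hM₂pos : (0 : ℝ) < M₂ := by exact_mod_cast hM₂
  -- the Abel weight v(h) = MM(h) / ((2h-n) C(n,h)), extended through the centre
  set VV : ℕ → ℝ := fun t => MM t / ((2 * (t : ℝ) - ((M₂ : ℝ) + L)) * ((M₂ + L).choose t : ℝ)) with hVV
  set v : ℕ → ℝ := fun h => if 2 * h = M₂ + L then VV (h + 1) else VV h with hv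
  have hchpos : ∀ t, t ≤ M₂ + L → (0 : ℝ) < ((M₂ + L).choose t : ℝ) := fun t ht => by
    exact_mod_cast Nat.choose_pos ht
  -- MM(h) = (2h-n) v(h) C(n,h)
  have hMv : ∀ h, h ≤ M₂ + L → MM h = (2 * (h : ℝ) - ((M₂ : ℝ) + L)) * v h * ((M₂ + L).choose h : ℝ) := by
    intro h hh
    by_cases hc : 2 * h = M₂ + L
    · rw [hMcen h hc]
      have : (2 * (h : ℝ) - ((M₂ : ℝ) + L)) = 0 := by
        have : ((2 * h : ℕ) : ℝ) = ((M₂ + L : ℕ) : ℝ) := by rw [hc]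
        push_cast at this; linarith
      rw [this]; ring
    · have hvh : v h = VV h := by
        show (if 2 * h = M₂ + L then VV (h + 1) else VV h) = VV h
        rw [if_neg hc]
      rw [hvh]
      show MM h = (2 * (h : ℝ) - ((M₂ : ℝ) + L)) *
        (MM h / ((2 * (h : ℝ) - ((M₂ : ℝ) + L)) * ((M₂ + L).choose h : ℝ))) * ((M₂ + L).choose h : ℝ)
      have hs : (2 * (h : ℝ) - ((M₂ : ℝ) + L)) ≠ 0 := by
        intro h0
        apply hc
        have : ((2 * h : ℕ) : ℝ) = ((M₂ + L : ℕ) : ℝ) := by push_cast; linarith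
        exact_mod_cast this
      have hcne : ((M₂ + L).choose h : ℝ) ≠ 0 := (hchpos h hh).ne'
      field_simp
  -- VV is symmetric about n/2 off the centre, and nonnegative
  have hVVsym : ∀ k, k ≤ M₂ + L → VV (M₂ + L - k) = VV k := by
    intro k hk
    show MM (M₂ + L - k) / ((2 * (((M₂ + L - k : ℕ)) : ℝ) - ((M₂ : ℝ) + L)) * ((M₂ + L).choose (M₂ + L - k) : ℝ)) =
      MM k / ((2 * (k : ℝ) - ((M₂ : ℝ) + L)) * ((M₂ + L).choose k : ℝ))
    rw [hModd k hk, Nat.choose_symm hk]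
    push_cast [Nat.cast_sub hk]
    rw [show (2 * (((M₂ : ℝ) + L) - k) - ((M₂ : ℝ) + L)) = -(2 * (k : ℝ) - ((M₂ : ℝ) + L)) by ring, neg_mul,
      neg_div_neg_eq]
  have hVVnn : ∀ k, k ≤ M₂ + L → M₂ + L < 2 * k → 0 ≤ VV k := by
    intro k hk hk2
    show 0 ≤ MM k / ((2 * (k : ℝ) - ((M₂ : ℝ) + L)) * ((M₂ + L).choose k : ℝ))
    apply div_nonneg (hMnn k (by omega))
    apply mul_nonneg _ (hchpos k hk).le
    have : ((M₂ + L : ℕ) : ℝ) < ((2 * k : ℕ) : ℝ) := by exact_mod_cast hk2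
    push_cast at this; linarith
  have hvVV : ∀ h, 2 * h ≠ M₂ + L → v h = VV h := by
    intro h hc
    show (if 2 * h = M₂ + L then VV (h + 1) else VV h) = VV h
    rw [if_neg hc]
  have hvcen : ∀ h, 2 * h = M₂ + L → v h = VV (h + 1) := by
    intro h hc
    show (if 2 * h = M₂ + L then VV (h + 1) else VV h) = VV (h + 1)
    rw [if_pos hc]
  -- v ≥ 0 on [0, n]
  have hvnn : ∀ h, h ≤ M₂ + L → 0 ≤ v h := by
    intro h hh
    by_cases hc : 2 * h = M₂ + L
    · rw [hvcen h hc]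
      exact hVVnn (h + 1) (by omega) (by omega)
    · rw [hvVV h hc]
      rcases Nat.lt_or_ge (M₂ + L) (2 * h) with hlt | hge
      · exact hVVnn h hh hlt
      · rw [← hVVsym h hh]
        exact hVVnn (M₂ + L - h) (by omega) (by omega)
  -- v symmetric
  have hvsym : ∀ h, h ≤ M₂ + L → v h = v (M₂ + L - h) := by
    intro h hh
    by_cases hc : 2 * h = M₂ + L
    · have : M₂ + L - h = h := by omega
      rw [this]
    · rw [hvVV h hc, hvVV (M₂ + L - h) (by omega), hVVsym h hh]
  -- v unimodal (Lemma B1)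
  have hvuni : ∀ h, 2 * h + 2 ≤ M₂ + L → v h ≤ v (h + 1) := by
    intro h hh
    rcases Nat.lt_or_ge (2 * h + 2) (M₂ + L) with hlt | hge
    · -- both off-centre, below: v h = VV(n-h), v(h+1) = VV(n-h-1), and lam_step at n-h-1
      rw [hvVV h (by omega), hvVV (h + 1) (by omega), ← hVVsym h (by omega), ← hVVsym (h + 1) (by omega)]
      have e : M₂ + L - h = (M₂ + L - (h + 1)) + 1 := by omega
      rw [e]
      have key := hlam (M₂ + L - (h + 1)) (by omega) (by omega)
      have hc : (((M₂ + L - (h + 1) : ℕ)) : ℝ) + 1 = (((M₂ + L - (h + 1) + 1 : ℕ)) : ℝ) := by push_cast; ring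
      show MM (M₂ + L - (h + 1) + 1) / ((2 * (((M₂ + L - (h + 1) + 1 : ℕ)) : ℝ) - ((M₂ : ℝ) + L)) *
          ((M₂ + L).choose (M₂ + L - (h + 1) + 1) : ℝ)) ≤
        MM (M₂ + L - (h + 1)) / ((2 * (((M₂ + L - (h + 1) : ℕ)) : ℝ) - ((M₂ : ℝ) + L)) *
          ((M₂ + L).choose (M₂ + L - (h + 1)) : ℝ))
      rw [← hc]
      exact key
    · -- 2h+2 = n: v h = VV h = VV (n-h) = VV (h+2) = v (h+1)
      have hc : 2 * (h + 1) = M₂ + L := by omega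
      rw [hvcen (h + 1) hc, hvVV h (by omega), ← hVVsym h (by omega)]
      have e : M₂ + L - h = h + 1 + 1 := by omega
      rw [e]
  -- the bound C(n,h) v(h) ≤ (M₂/n) FF(h)  (Lemma B2 = Mo_upper; F_step at the centre)
  have hbound : ∀ h, h ≤ M₂ + L → ((M₂ + L).choose h : ℝ) * v h ≤ (M₂ : ℝ) / ((M₂ : ℝ) + L) * FF h := by
    -- off-centre, above: directly from Mo_upper
    have above : ∀ k, k ≤ M₂ + L → M₂ + L < 2 * k →
        ((M₂ + L).choose k : ℝ) * VV k ≤ (M₂ : ℝ) / ((M₂ : ℝ) + L) * FF k := by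
      intro k hk hk2
      have hs : 0 < (2 * (k : ℝ) - ((M₂ : ℝ) + L)) := by
        have : ((M₂ + L : ℕ) : ℝ) < ((2 * k : ℕ) : ℝ) := by exact_mod_cast hk2
        push_cast at this; linarith
      have hcp := hchpos k hk
      have e : ((M₂ + L).choose k : ℝ) * VV k = MM k / (2 * (k : ℝ) - ((M₂ : ℝ) + L)) := by
        show ((M₂ + L).choose k : ℝ) * (MM k / ((2 * (k : ℝ) - ((M₂ : ℝ) + L)) * ((M₂ + L).choose k : ℝ))) = _
        field_simp
      rw [e, div_le_iff₀ hs]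
      have hup := hMup k (by omega)
      rw [show (M₂ : ℝ) / ((M₂ : ℝ) + L) * FF k * (2 * (k : ℝ) - ((M₂ : ℝ) + L)) =
        ((2 * (k : ℝ) - ((M₂ : ℝ) + L)) * M₂ * FF k) / ((M₂ : ℝ) + L) by ring, le_div_iff₀ hnpos]
      have e7 : (2 * (k : ℝ) - M₂ - L) = (2 * (k : ℝ) - ((M₂ : ℝ) + L)) := by ring
      rw [e7] at hup
      linarith [hup]
    intro h hh
    by_cases hc : 2 * h = M₂ + L
    · -- the centre: v h = VV(h+1); Mo_upper at h+1 and F_step at h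
      rw [hvcen h hc]
      have hh1 : h + 1 ≤ M₂ + L := by omega
      have hhpos : (0 : ℝ) < h := by
        have : 1 ≤ h := by omega
        exact_mod_cast this
      have hc0 := hchpos h hh
      have hc1 := hchpos (h + 1) hh1
      have hrel : ((M₂ + L).choose (h + 1) : ℝ) * ((h : ℝ) + 1) = ((M₂ + L).choose h : ℝ) * (h : ℝ) := by
        have := ThetaBound.rel_y (M₂ + L) h
        have e : (((M₂ + L : ℕ) : ℝ) - h) = (h : ℝ) := by
          have : ((2 * h : ℕ) : ℝ) = ((M₂ + L : ℕ) : ℝ) := by rw [hc]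
          push_cast at this ⊢; linarith
        rw [e] at this
        exact_mod_cast this
      have hstep := hFstep h (by omega)
      have e2 : ((M₂ : ℝ) + L - h) = (h : ℝ) := by
        have : ((2 * h : ℕ) : ℝ) = ((M₂ + L : ℕ) : ℝ) := by rw [hc]
        push_cast at this; linarith
      rw [e2] at hstep
      have hup := hMup (h + 1) (by omega)
      have e3 : (2 * (((h + 1 : ℕ)) : ℝ) - M₂ - L) = 2 := by
        have : ((2 * h : ℕ) : ℝ) = ((M₂ + L : ℕ) : ℝ) := by rw [hc]
        push_cast at this ⊢; linarith
      rw [e3] at hup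
      -- C(n,h) VV(h+1) = C(n,h) MM(h+1) / (2 C(n,h+1))
      have e4 : ((M₂ + L).choose h : ℝ) * VV (h + 1) =
          ((M₂ + L).choose h : ℝ) * MM (h + 1) / (2 * ((M₂ + L).choose (h + 1) : ℝ)) := by
        show ((M₂ + L).choose h : ℝ) * (MM (h + 1) / ((2 * (((h + 1 : ℕ)) : ℝ) - ((M₂ : ℝ) + L)) *
          ((M₂ + L).choose (h + 1) : ℝ))) = _
        have e5 : (2 * (((h + 1 : ℕ)) : ℝ) - ((M₂ : ℝ) + L)) = 2 := by linarith
        rw [e5]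
        field_simp
      rw [e4, div_le_iff₀ (by positivity)]
      rw [show (M₂ : ℝ) / ((M₂ : ℝ) + L) * FF h * (2 * ((M₂ + L).choose (h + 1) : ℝ)) =
        (2 * (M₂ : ℝ) * FF h * ((M₂ + L).choose (h + 1) : ℝ)) / ((M₂ : ℝ) + L) by ring, le_div_iff₀ hnpos]
      -- goal: C0 * MM(h+1) * n ≤ 2 M₂ FF h C1;  use n MM(h+1) ≤ 2 M₂ FF(h+1) and C0 FF(h+1) ≤ C1 FF h
      have hCF : ((M₂ + L).choose h : ℝ) * FF (h + 1) ≤ ((M₂ + L).choose (h + 1) : ℝ) * FF h := by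
        have h5 := mul_le_mul_of_nonneg_left hstep hc1.le
        have e6 : ((M₂ + L).choose (h + 1) : ℝ) * (((h : ℝ) + 1) * FF (h + 1)) =
            (h : ℝ) * (((M₂ + L).choose h : ℝ) * FF (h + 1)) := by
          rw [← mul_assoc, hrel]
          ring
        rw [e6] at h5
        have h7 : (h : ℝ) * (((M₂ + L).choose h : ℝ) * FF (h + 1)) ≤
            (h : ℝ) * (((M₂ + L).choose (h + 1) : ℝ) * FF h) := by
          have e8 : ((M₂ + L).choose (h + 1) : ℝ) * ((h : ℝ) * FF h) =
              (h : ℝ) * (((M₂ + L).choose (h + 1) : ℝ) * FF h) := by ring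
          rw [e8] at h5
          exact h5
        exact le_of_mul_le_mul_left h7 hhpos
      have h8 := mul_le_mul_of_nonneg_left hup hc0.le
      have h9 := mul_le_mul_of_nonneg_left hCF (by positivity : (0 : ℝ) ≤ 2 * (M₂ : ℝ))
      have e10 : ((M₂ + L).choose h : ℝ) * (((M₂ : ℝ) + L) * MM (h + 1)) =
          ((M₂ + L).choose h : ℝ) * MM (h + 1) * ((M₂ : ℝ) + L) := by ring
      have e11 : ((M₂ + L).choose h : ℝ) * (2 * (M₂ : ℝ) * FF (h + 1)) =
          2 * (M₂ : ℝ) * (((M₂ + L).choose h : ℝ) * FF (h + 1)) := by ring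
      have e12 : 2 * (M₂ : ℝ) * (((M₂ + L).choose (h + 1) : ℝ) * FF h) =
          2 * (M₂ : ℝ) * FF h * ((M₂ + L).choose (h + 1) : ℝ) := by ring
      linarith [h8, h9, e10, e11, e12]
    · rw [hvVV h hc]
      rcases Nat.lt_or_ge (M₂ + L) (2 * h) with hlt | hge
      · exact above h hh hlt
      · -- below the centre: reflect
        rw [← hVVsym h hh, ← hFsym h hh, ← Nat.choose_symm hh]
        exact above (M₂ + L - h) (by omega) (by omega)
  -- ### the reduction
  have hKr : (2 : ℝ) * K = (M₁ : ℝ) + M₂ + L - j := by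
    have : ((2 * K + j : ℕ) : ℝ) = ((M₁ + M₂ + L : ℕ) : ℝ) := by rw [hN]
    push_cast at this
    linarith
  -- Step 1: the summand as `if x₁ ≤ K then Ψ x₁ (K - x₁) else 0`
  set Ψ : ℕ → ℕ → ℝ := fun x h => if i₁ ≤ x ∧ x ≤ M₁ - i₁ then
    (M₁.choose x : ℝ) * (κ * FF h + (2 * (x : ℝ) - M₁) * MM h) else 0 with hΨ
  have e1 : ∀ x₁ ∈ range (M₁ + 1), (if i₁ ≤ x₁ ∧ x₁ ≤ M₁ - i₁ then (M₁.choose x₁ : ℝ) *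
      (if x₁ ≤ K then
        κ * (∑ x ∈ range (M₂ + 1), (M₂.choose x : ℝ) *
            (if x ≤ K - x₁ then (L.choose (K - x₁ - x) : ℝ) else 0) * w₂ x) +
        (2 * (x₁ : ℝ) - M₁) * (∑ x ∈ range (M₂ + 1), (M₂.choose x : ℝ) *
            (if x ≤ K - x₁ then (L.choose (K - x₁ - x) : ℝ) else 0) * w₂ x * (2 * (x : ℝ) - M₂))
      else 0) else 0) = (if x₁ ≤ K then Ψ x₁ (K - x₁) else 0) := by
    intro x₁ _
    by_cases hxK : x₁ ≤ K
    · -- both sides agree definitionally once the guards `x₁ ≤ K` are resolved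
      rw [if_pos hxK, if_pos hxK]
    · rw [if_neg hxK, if_neg hxK]
      by_cases hw : i₁ ≤ x₁ ∧ x₁ ≤ M₁ - i₁
      · rw [if_pos hw, mul_zero]
      · rw [if_neg hw]
  have hΨz : ∀ x h, M₂ + L < h → Ψ x h = 0 := by
    intro x h hh
    show (if i₁ ≤ x ∧ x ≤ M₁ - i₁ then
      (M₁.choose x : ℝ) * (κ * FF h + (2 * (x : ℝ) - M₁) * MM h) else 0) = 0
    rw [hFz h hh, hMz h hh]
    split_ifs <;> ring
  rw [sum_congr rfl e1, UZeroBase.reindex M₁ K (M₂ + L) Ψ hΨz]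
  -- Step 3: one predicate Q h
  have e3 : ∀ h ∈ range (M₂ + L + 1), (if h ≤ K ∧ K - h ≤ M₁ then Ψ (K - h) h else 0) =
      (if h ≤ K ∧ i₁ ≤ K - h ∧ K - h ≤ M₁ - i₁ then
        (M₁.choose (K - h) : ℝ) * (κ * FF h + (2 * (((K - h : ℕ)) : ℝ) - M₁) * MM h) else 0) := by
    intro h _
    by_cases hc : h ≤ K ∧ K - h ≤ M₁
    · rw [if_pos hc]
      show (if i₁ ≤ K - h ∧ K - h ≤ M₁ - i₁ then
        (M₁.choose (K - h) : ℝ) * (κ * FF h + (2 * (((K - h : ℕ)) : ℝ) - M₁) * MM h) else 0) = _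
      by_cases hw : i₁ ≤ K - h ∧ K - h ≤ M₁ - i₁
      · rw [if_pos hw, if_pos ⟨hc.1, hw⟩]
      · rw [if_neg hw, if_neg (fun hc' => hw hc'.2)]
    · rw [if_neg hc, if_neg (fun hc' => hc ⟨hc'.1, by omega⟩)]
  rw [sum_congr rfl e3]
  -- Step 4: split into the κ-part A and the moment part B
  set A := ∑ h ∈ range (M₂ + L + 1), (if h ≤ K ∧ i₁ ≤ K - h ∧ K - h ≤ M₁ - i₁ then
    (M₁.choose (K - h) : ℝ) * FF h else 0) with hA
  set G := ∑ h ∈ range (M₂ + L + 1), (if h ≤ K ∧ i₁ ≤ K - h ∧ K - h ≤ M₁ - i₁ then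
    ((M₂ + L).choose h : ℝ) * (M₁.choose (K - h) : ℝ) *
      ((2 * (h : ℝ) - ((M₂ + L : ℕ) : ℝ)) * (2 * (h : ℝ) - ((M₂ + L : ℕ) : ℝ) + j)) else 0) * v h with hG
  set V := ∑ h ∈ range (M₂ + L + 1), (if h ≤ K ∧ i₁ ≤ K - h ∧ K - h ≤ M₁ - i₁ then
    ((M₂ + L).choose h : ℝ) * (M₁.choose (K - h) : ℝ) else 0) * v h with hV
  have hsplit : ∑ h ∈ range (M₂ + L + 1), (if h ≤ K ∧ i₁ ≤ K - h ∧ K - h ≤ M₁ - i₁ then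
      (M₁.choose (K - h) : ℝ) * (κ * FF h + (2 * (((K - h : ℕ)) : ℝ) - M₁) * MM h) else 0) = κ * A - G := by
    rw [hA, hG, mul_sum, ← sum_sub_distrib]
    refine sum_congr rfl fun h hh => ?_
    have hhn : h ≤ M₂ + L := by have := mem_range.mp hh; omega
    by_cases hq : h ≤ K ∧ i₁ ≤ K - h ∧ K - h ≤ M₁ - i₁
    · rw [if_pos hq, if_pos hq, if_pos hq, hMv h hhn]
      push_cast [Nat.cast_sub hq.1]
      rw [show ((M₁ : ℝ)) = 2 * K - M₂ - L + j by linarith]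
      ring
    · rw [if_neg hq, if_neg hq, if_neg hq]
      ring
  rw [hsplit]
  -- Step 5: Abel summation in h against Proposition Z, with κ₀ = κ n / M₂
  set κ₀ : ℝ := κ * ((M₂ : ℝ) + L) / M₂ with hκ₀def
  have hκ₀nn : 0 ≤ κ₀ := by rw [hκ₀def]; positivity
  have hκ₀' : (M₁ : ℝ) * ((M₂ + L : ℕ) : ℝ) * (((M₁ : ℝ) + ((M₂ + L : ℕ) : ℝ)) - (j : ℝ) ^ 2) ≤
      κ₀ * (((M₁ : ℝ) + ((M₂ + L : ℕ) : ℝ)) * (((M₁ : ℝ) + ((M₂ + L : ℕ) : ℝ)) - 1)) := by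
    push_cast at hκ₀ ⊢
    rw [hκ₀def]
    have e : κ * ((M₂ : ℝ) + L) / M₂ * (((M₁ : ℝ) + ((M₂ : ℝ) + L)) * (((M₁ : ℝ) + ((M₂ : ℝ) + L)) - 1)) =
        (κ * (((M₁ : ℝ) + M₂ + L) * (((M₁ : ℝ) + M₂ + L) - 1))) * (((M₂ : ℝ) + L) / M₂) := by
      field_simp
      ring
    rw [e]
    have e2 : (M₁ : ℝ) * ((M₂ : ℝ) + L) * (((M₁ : ℝ) + ((M₂ : ℝ) + L)) - (j : ℝ) ^ 2) =
        ((M₁ : ℝ) * M₂ * (((M₁ : ℝ) + M₂ + L) - (j : ℝ) ^ 2)) * (((M₂ : ℝ) + L) / M₂) := by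
      field_simp
      ring
    rw [e2]
    exact mul_le_mul_of_nonneg_right hκ₀ (by positivity)
  set a : ℕ → ℝ := fun h => if h ≤ K ∧ i₁ ≤ K - h ∧ K - h ≤ M₁ - i₁ then
    ((M₂ + L).choose h : ℝ) * (M₁.choose (K - h) : ℝ) *
      (κ₀ - (2 * (h : ℝ) - ((M₂ + L : ℕ) : ℝ)) * (2 * (h : ℝ) - ((M₂ + L : ℕ) : ℝ) + j)) else 0 with ha
  have hW : ∀ i, 0 ≤ ∑ h ∈ range (M₂ + L + 1), (if i ≤ h ∧ h ≤ M₂ + L - i then a h else 0) :=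
    fun i => UZero.propZ M₁ (M₂ + L) K j (by omega) hM₁ hn1 κ₀ hκ₀nn hκ₀' i₁ i
  have habel := Shells.abel_window (M₂ + L) a hW (M₂ + L + 1) 0 (by omega) v
    (fun h _ hh => hvnn h (by omega)) hvsym hvuni
  have e5 : ∑ h ∈ range (M₂ + L + 1), (if 0 ≤ h ∧ h ≤ M₂ + L - 0 then a h * v h else 0) = κ₀ * V - G := by
    rw [hV, hG, mul_sum, ← sum_sub_distrib]
    refine sum_congr rfl fun h hh => ?_
    have hhn : h ≤ M₂ + L := by have := mem_range.mp hh; omega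
    rw [if_pos ⟨Nat.zero_le h, by omega⟩]
    show (if h ≤ K ∧ i₁ ≤ K - h ∧ K - h ≤ M₁ - i₁ then
      ((M₂ + L).choose h : ℝ) * (M₁.choose (K - h) : ℝ) *
        (κ₀ - (2 * (h : ℝ) - ((M₂ + L : ℕ) : ℝ)) * (2 * (h : ℝ) - ((M₂ + L : ℕ) : ℝ) + j)) else 0) * v h = _
    split_ifs <;> ring
  rw [e5] at habel
  -- Step 6: V ≤ (M₂/n) A termwise (Lemma B2)
  have hVA : V ≤ (M₂ : ℝ) / ((M₂ : ℝ) + L) * A := by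
    rw [hV, hA, mul_sum]
    apply sum_le_sum
    intro h hh
    have hhn : h ≤ M₂ + L := by have := mem_range.mp hh; omega
    by_cases hq : h ≤ K ∧ i₁ ≤ K - h ∧ K - h ≤ M₁ - i₁
    · rw [if_pos hq, if_pos hq]
      have hb := hbound h hhn
      have hc : 0 ≤ (M₁.choose (K - h) : ℝ) := by positivity
      have := mul_le_mul_of_nonneg_left hb hc
      nlinarith [this]
    · rw [if_neg hq, if_neg hq]
      simp
  -- Step 7: conclude  κ A - G ≥ κ A - κ₀ V ≥ κ A - κ₀ (M₂/n) A = 0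
  have hAnn : 0 ≤ A := by
    rw [hA]
    apply sum_nonneg
    intro h _
    split_ifs
    · exact mul_nonneg (by positivity) (hFnn h)
    · exact le_rfl
  have hκκ : κ₀ * ((M₂ : ℝ) / ((M₂ : ℝ) + L)) = κ := by
    rw [hκ₀def]
    field_simp
  have h1 : κ₀ * V ≤ κ₀ * ((M₂ : ℝ) / ((M₂ : ℝ) + L) * A) := mul_le_mul_of_nonneg_left hVA hκ₀nn
  have h2 : κ₀ * ((M₂ : ℝ) / ((M₂ : ℝ) + L) * A) = κ * A := by rw [← mul_assoc, hκκ]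
  linarith

end UWin

end Summit.CriticalPhenomena.PercolationContinuityZ3.Theorems
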